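import Summits.ValiantsHypothesis.ValiantsHypothesis.Theorems.KPlusLogSqLawValuativeDoorSquaring
import Summits.ValiantsHypothesis.ValiantsHypothesis.Theorems.KPlusLogSqLawValuativeDoorProductCount

/-!
# LINE `valuative_door` (crux `WeakLifting`, stmt-ValiantsHypothesis-19561) — the lemma `ValCongruenceLemma` of
# `Cruxes/WeakLifting/Lines/valuative_door.lean` (rev 2 @84c5f76c6d22) PROVED in its unfolded form: «located inflation is harmless under
# common congruence» — letters `A · diag(D_l) · Aᵀ` give at most `m (K − 1)` root radii

HONEST FRAMING.  Helper (cell `pub-symmetroid`, seat val-sym-lift-p1 g21, 2026-08-29; `--supports 19561 --as helper`).  For letters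
`S_l = A · diagonal (D l) · Aᵀ` the lacunary pencil is `A · diagonal (g) · Aᵀ` over `F[X]` with `g i = Σ_l D l i · X^{d l}`, so
`det = C (det A)² · Π_i g i`; each `g i` has at most `K` monomials hence at most `K − 1` Newton edges, and for a NON-ARCHIMEDEAN `v` the
edge count of a product is at most the sum (`npEdges_mul_le` of `…ValuativeDoorProductCount`) while a nonzero constant factor changes nothing
(`dominant_C_mul` of `…ValuativeDoorSquaring`); total `≤ m (K − 1)`.  The statement is the skeleton's `ValCongruenceLemma` with `npEdges` /
`domCount` UNFOLDED binder for binder (docking by `exact`).  A lemma of the line's card (tag S), NOT a stub and NOT the crux; closes nothing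
on the ledger by itself; no bearing on vW / vB / `ValRankOneLaw`, `TropicalB`, `MatrixDescartes` (18050) or VP ≠ VNP.  [elementary]
-/

set_option linter.dupNamespace false
set_option autoImplicit false

namespace Summit.ValiantsHypothesis.ValiantsHypothesis.Theorems.KPlusLogSqLaw.ValDoor

open Polynomial Finset Matrix
open scoped BigOperators Classical

variable {F : Type*} [Field F]

/-- **the congruence pencil factors**: `Σ_l X^{d l} • (A · diagonal (D l) · Aᵀ) = A · diagonal (g) · Aᵀ` over `F[X]`,
`g i = Σ_l C (D l i) · X^{d l}`. [bookkeeping] -/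
theorem congruencePencil_eq {m K : ℕ} (d : Fin K → ℕ) (A : Matrix (Fin m) (Fin m) F) (D : Fin K → Fin m → F) :
    (∑ l, (X : F[X]) ^ d l • (A * Matrix.diagonal (D l) * A.transpose).map (C : F →+* F[X]))
      = A.map (C : F →+* F[X]) * Matrix.diagonal (fun i => ∑ l, C (D l i) * (X : F[X]) ^ d l)
          * (A.map (C : F →+* F[X])).transpose := by
  refine Matrix.ext fun a b => ?_
  rw [Matrix.sum_apply]
  simp only [Matrix.smul_apply, Matrix.map_apply, smul_eq_mul, Matrix.mul_apply, Matrix.transpose_apply,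
    Matrix.diagonal_apply, mul_ite, mul_zero, Finset.sum_ite_eq', Finset.mem_univ, if_true, map_sum, map_mul,
    Finset.mul_sum, Finset.sum_mul]
  rw [Finset.sum_comm]
  refine Finset.sum_congr rfl fun j _ => Finset.sum_congr rfl fun l _ => ?_
  ring

/-- **its determinant**: `det = C ((det A)²) · Π_i g i`. [bookkeeping] -/
theorem det_congruencePencil {m K : ℕ} (d : Fin K → ℕ) (A : Matrix (Fin m) (Fin m) F) (D : Fin K → Fin m → F) :
    (∑ l, (X : F[X]) ^ d l • (A * Matrix.diagonal (D l) * A.transpose).map (C : F →+* F[X])).det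
      = C (A.det ^ 2) * ∏ i, ∑ l, C (D l i) * (X : F[X]) ^ d l := by
  rw [congruencePencil_eq, Matrix.det_mul, Matrix.det_mul, Matrix.det_transpose, Matrix.det_diagonal,
    ← RingHom.mapMatrix_apply, ← RingHom.map_det, map_pow]
  ring

/-- a `K`-nomial has at most `K` support exponents, hence at most `K` dominant ones. [bookkeeping] -/
theorem card_support_lacunary_le {K : ℕ} (d : Fin K → ℕ) (c : Fin K → F) :
    (∑ l, C (c l) * (X : F[X]) ^ d l).support.card ≤ K := by
  have hsub : (∑ l, C (c l) * (X : F[X]) ^ d l).support ⊆ univ.image d := by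
    intro E hE
    rw [Polynomial.mem_support_iff, Polynomial.finsetSum_coeff] at hE
    by_contra hEi
    apply hE
    refine Finset.sum_eq_zero fun l _ => ?_
    rw [Polynomial.coeff_C_mul_X_pow, if_neg]
    intro h
    exact hEi (Finset.mem_image.2 ⟨l, Finset.mem_univ _, h.symm⟩)
  calc (∑ l, C (c l) * (X : F[X]) ^ d l).support.card ≤ (univ.image d).card := Finset.card_le_card hsub
    _ ≤ (univ : Finset (Fin K)).card := Finset.card_image_le
    _ = K := by rw [Finset.card_univ, Fintype.card_fin]

/-- **edges of a finite product** (non-archimedean `v`): `npEdges (Π_{i∈s} g i) ≤ Σ_{i∈s} npEdges (g i)` on the raw predicate.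
[induction on `s` with `npEdges_mul_le`] -/
theorem npEdges_prod_le {ι : Type*} (v : AbsoluteValue F ℝ) (hv : IsNonarchimedean v) (s : Finset ι) (g : ι → F[X]) :
    ((∏ i ∈ s, g i).support.filter fun E => ∃ r : ℝ, 0 < r ∧ ∀ E' ∈ (∏ i ∈ s, g i).support, E' ≠ E →
        v ((∏ i ∈ s, g i).coeff E') * r ^ E' < v ((∏ i ∈ s, g i).coeff E) * r ^ E).card - 1
      ≤ ∑ i ∈ s, (((g i).support.filter fun E => ∃ r : ℝ, 0 < r ∧ ∀ E' ∈ (g i).support, E' ≠ E →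
        v ((g i).coeff E') * r ^ E' < v ((g i).coeff E) * r ^ E).card - 1) := by
  induction s using Finset.induction_on with
  | empty =>
    rw [Finset.sum_empty, Finset.prod_empty]
    have h : ((1 : F[X]).support.filter fun E => ∃ r : ℝ, 0 < r ∧ ∀ E' ∈ (1 : F[X]).support, E' ≠ E →
        v ((1 : F[X]).coeff E') * r ^ E' < v ((1 : F[X]).coeff E) * r ^ E).card ≤ 1 :=
      (Finset.card_filter_le _ _).trans ((Polynomial.card_supp_le_succ_natDegree _).trans (by rw [natDegree_one]))
    omega
  | insert i s hi ih =>
    rw [Finset.prod_insert hi, Finset.sum_insert hi]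
    have h := npEdges_mul_le v hv (g i) (∏ j ∈ s, g j)
    omega

/-- **`ValCongruenceLemma` UNFOLDED** (the line's lemma, literally): over every non-archimedean valued field of characteristic zero, the
lacunary pencil with letters `A · diagonal (D l) · Aᵀ` has `npEdges ≤ m (K − 1)`. [elementary: `det = C(det A)² · Π_i g i`, each `g i` a
`K`-nomial, edges of a product add up] -/
theorem valCongruenceLemma_unfolded :
    ∀ (F : Type) [Field F] [CharZero F] (v : AbsoluteValue F ℝ), IsNonarchimedean v →
      ∀ (m K : ℕ) (d : Fin K → ℕ) (A : Matrix (Fin m) (Fin m) F) (D : Fin K → Fin m → F),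
        ((Matrix.det (∑ l, ((Polynomial.X : Polynomial F) ^ d l) •
            (A * Matrix.diagonal (D l) * A.transpose).map Polynomial.C)).support.filter fun E =>
            ∃ r : ℝ, 0 < r ∧ ∀ E' ∈ (Matrix.det (∑ l, ((Polynomial.X : Polynomial F) ^ d l) •
              (A * Matrix.diagonal (D l) * A.transpose).map Polynomial.C)).support, E' ≠ E →
              v ((Matrix.det (∑ l, ((Polynomial.X : Polynomial F) ^ d l) •
                (A * Matrix.diagonal (D l) * A.transpose).map Polynomial.C)).coeff E') * r ^ E'
                < v ((Matrix.det (∑ l, ((Polynomial.X : Polynomial F) ^ d l) •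
                  (A * Matrix.diagonal (D l) * A.transpose).map Polynomial.C)).coeff E) * r ^ E).card - 1
          ≤ m * (K - 1) := by
  intro F _ _ v hv m K d A D
  rw [det_congruencePencil]
  by_cases hA : A.det = 0
  · simp [hA]
  · rw [dominant_C_mul v _ (pow_ne_zero 2 hA)]
    refine (npEdges_prod_le v hv (univ : Finset (Fin m)) (fun i => ∑ l, C (D l i) * (X : F[X]) ^ d l)).trans ?_
    calc ∑ i : Fin m, (((∑ l, C (D l i) * (X : F[X]) ^ d l).support.filter fun E => ∃ r : ℝ, 0 < r ∧
              ∀ E' ∈ (∑ l, C (D l i) * (X : F[X]) ^ d l).support, E' ≠ E →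
                v ((∑ l, C (D l i) * (X : F[X]) ^ d l).coeff E') * r ^ E'
                  < v ((∑ l, C (D l i) * (X : F[X]) ^ d l).coeff E) * r ^ E).card - 1)
          ≤ ∑ _i : Fin m, (K - 1) := by
            refine Finset.sum_le_sum fun i _ => ?_
            have h1 := Finset.card_filter_le ((∑ l, C (D l i) * (X : F[X]) ^ d l).support)
              (fun E => ∃ r : ℝ, 0 < r ∧ ∀ E' ∈ (∑ l, C (D l i) * (X : F[X]) ^ d l).support, E' ≠ E →
                v ((∑ l, C (D l i) * (X : F[X]) ^ d l).coeff E') * r ^ E'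
                  < v ((∑ l, C (D l i) * (X : F[X]) ^ d l).coeff E) * r ^ E)
            have h2 := card_support_lacunary_le d (fun l => D l i)
            omega
      _ = m * (K - 1) := by rw [Finset.sum_const, Finset.card_univ, Fintype.card_fin, smul_eq_mul]

end Summit.ValiantsHypothesis.ValiantsHypothesis.Theorems.KPlusLogSqLaw.ValDoor
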